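import Summits.KontsevichZagierPeriods.KontsevichZagierPeriods.Theorems.SoloInformedParamCoin
import Summits.KontsevichZagierPeriods.KontsevichZagierPeriods.Theorems.SoloInformedParamClass
import Summits.KontsevichZagierPeriods.KontsevichZagierPeriods.Theorems.SoloInformedTameCircleSquaring
import HarnessLib

/-!
# THEOREM R for bounded `KZ_ℝ` chains (kernel form, conditional on generator definability)

**Real-parameter barrier.** Let `r` be a bounded integral representation over `ℚ` with
TRANSCENDENTAL value (e.g. a bounded representation of `log 2`). If every bounded generator of
`KZ_ℝ` satisfies the definability invariant (`SoloInformedDefinableRel`, file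
`SoloInformedParamCombo`; discharged move by move in the sequel files), then for every `ℓ ≥ 0`
`[r ⊗ ℝ] − [[0,1] × [0,ℓ], 1]` is NOT a bounded relation of `KZ_ℝ`
(`soloInformed_realParameterBarrier_bdd`): no bounded chain of the four moves with real
semialgebraic data connects `r` to a rectangle, although for `ℓ = value r` both have the same
value. Equivalently: equality of values does not imply bounded `KZ_ℝ`-equivalence — the real-closed
analogue of Kontsevich–Zagier's Conjecture 1 FAILS for bounded chains, and any proof of the
conjecture must use the arithmetic of `ℚ̄` beyond first-order real-closed-field reasoning.

Proof: a chain is the value at `p₀` of a parametrised combination whose good parameters form a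
`ℚ`-semialgebraic set `V` (definability); add the rectangle height as a parameter and cut `V` by the
`ℚ`-semialgebraic coincidence clauses recording which terms are (copies of) `r`, the rectangle, or
each other at `p₀`; on the resulting set the class-function principle gives `height = value r`, a
transcendental constant — impossible for a nonempty `ℚ`-semialgebraic set
(`soloInformed_realParameter_barrier_core_fintype`).

References: [cite: KontsevichZagier2001, §1.2]; [cite: BochnakCosteRoy1998, Prop. 2.2.4, 5.2.3].
-/

noncomputable section

open Set MeasureTheory MvPolynomial Literature.ModelTheory.ExponentialFields
  Literature.NumberTheory.Transcendental

namespace Summit.KontsevichZagierPeriods.KontsevichZagierPeriods.Theorems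

variable {ι : Type*} {k : Type*} [CommRing k] [Algebra k ℝ]

/-- Universal quantification over a PROPOSITION preserves semialgebraicity. [folklore] -/
theorem soloInformed_isSemialgebraic_setOf_forall_prop {c : Prop} {Φ : c → (ι → ℝ) → Prop}
    (h : ∀ hc : c, IsSemialgebraic k {w | Φ hc w}) :
    IsSemialgebraic k {w : ι → ℝ | ∀ hc : c, Φ hc w} := by
  by_cases hc : c
  · convert h hc using 1
    ext w
    exact ⟨fun hw => hw hc, fun hw _ => hw⟩
  · convert (isSemialgebraic_univ : IsSemialgebraic k (univ : Set (ι → ℝ))) using 1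
    ext w
    exact ⟨fun _ => mem_univ _, fun _ hc' => absurd hc' hc⟩

/-- A coordinate half-space `{q | 0 ≤ q a}` is `ℚ`-semialgebraic. [folklore] -/
theorem soloInformed_isSemialgebraic_setOf_coord_nonneg (a : ι) :
    IsSemialgebraic ℚ {q : ι → ℝ | 0 ≤ q a} := by
  simpa [aeval_X] using isSemialgebraic_setOf_eval_le (k := ℚ) (R := ℝ)
    (0 : MvPolynomial ι ℚ) (X a)

/-- **Degenerate case of THEOREM R**: a bounded `ℚ`-representation with transcendental value is not
literally a rectangle `[[0,1] × [0,ℓ], 1]`. [cite: BochnakCosteRoy1998, Prop. 5.2.3] -/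
theorem soloInformed_sigma_baseChange_ne_rect {n : ℕ} (r : KZOver.IntegralRep ℚ n)
    (hr : SoloInformedBddRep r) (hτ : Transcendental ℚ r.value) {ℓ : ℝ} (hℓ : 0 ≤ ℓ) :
    (⟨n, r.baseChange ℝ⟩ : Σ m, KZOver.IntegralRep ℝ m) ≠ ⟨2, soloInformedRealRect ℓ⟩ := by
  intro hAB
  obtain ⟨h, hcast⟩ := (SoloInformedPTerm.sigma_mk_eq_iff _ _).1 hAB
  let cA : SoloInformedPTerm (Fin 1) 2 := (SoloInformedPTerm.const (Fin 1) r).castDim h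
  let cB : SoloInformedPTerm (Fin 1) 2 := SoloInformedPTerm.rectTerm 0
  have hAadm : ∀ q, cA.SoloInformedAdm q := fun q =>
    (SoloInformedPTerm.adm_castDim_iff h _ q).2 (SoloInformedPTerm.adm_const r q hr)
  have hArep : ∀ q, cA.rep q = SoloInformedPTerm.castRep h (r.baseChange ℝ) := fun q => by
    rw [SoloInformedPTerm.rep_castDim, SoloInformedPTerm.rep_const r q hr]
  let Valid : (Fin 1 → ℝ) → Prop := fun q => 0 ≤ q 0 ∧ cA.SoloInformedCoin cB q
  have hV : IsSemialgebraic ℚ {q | Valid q} :=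
    soloInformed_isSemialgebraic_setOf_and (soloInformed_isSemialgebraic_setOf_coord_nonneg 0)
      (SoloInformedPTerm.isSemialgebraic_setOf_coin cA cB)
  have hsound : ∀ q, Valid q → aeval q (X 0 : MvPolynomial (Fin 1) ℚ) = r.value := by
    rintro q ⟨hq, hcoin⟩
    have hv :=
      SoloInformedPTerm.value_eq_of_coin hcoin (hAadm q) (SoloInformedPTerm.adm_rectTerm q 0)
    rw [SoloInformedPTerm.rep_rectTerm, soloInformedRealRect_value hq,
      SoloInformedPTerm.value_rep_castDim, SoloInformedPTerm.rep_const r q hr,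
      KZOver.IntegralRep.value_baseChange] at hv
    rw [aeval_X, hv]
  refine (soloInformed_realParameter_barrier_core_fintype hV (X 0) hsound).1 hτ (fun _ => ℓ)
    ⟨hℓ, SoloInformedPTerm.coin_of_rep_eq (hAadm _) (SoloInformedPTerm.adm_rectTerm _ 0) ?_⟩
  rw [hArep, hcast, SoloInformedPTerm.rep_rectTerm]

/-- **THEOREM R (bounded chains).** If the four bounded generators of `KZ_ℝ` are definable, then a
bounded `ℚ`-representation with transcendental value is not boundedly `KZ_ℝ`-equivalent to any
rectangle `[[0,1] × [0,ℓ], 1]`, `ℓ ≥ 0`. [cite: KontsevichZagier2001, §1.2, Conjecture 1] -/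
theorem soloInformed_realParameterBarrier_bdd
    (hgen : ∀ c ∈ soloInformedBddGenerators ℝ, SoloInformedDefinableRel c)
    {n : ℕ} (r : KZOver.IntegralRep ℚ n) (hr : SoloInformedBddRep r)
    (hτ : Transcendental ℚ r.value) {ℓ : ℝ} (hℓ : 0 ≤ ℓ) :
    KZOver.of (r.baseChange ℝ) - KZOver.of (soloInformedRealRect ℓ) ∉
      soloInformedRelationsBdd ℝ := by
  intro hc
  have hAB := soloInformed_sigma_baseChange_ne_rect r hr hτ hℓ
  obtain ⟨K, hK, P, p₀, V, hV, hp₀, hcombo, hgood, -⟩ :=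
    soloInformed_definableRel_of_mem_relationsBdd hgen hc
  -- parameters `K ⊕ Fin 1`: the old parameters and the height of the rectangle
  let kℓ : K ⊕ Fin 1 := Sum.inr 0
  let term' : (t : P.ι) → SoloInformedPTerm (K ⊕ Fin 1) (P.dim t) :=
    fun t => (P.term t).pullback Sum.inl
  let cA : SoloInformedPTerm (K ⊕ Fin 1) n := SoloInformedPTerm.const (K ⊕ Fin 1) r
  let cB : SoloInformedPTerm (K ⊕ Fin 1) 2 := SoloInformedPTerm.rectTerm kℓ
  have hterm_rep : ∀ t q, (term' t).rep q = (P.term t).rep (q ∘ Sum.inl) := fun t q =>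
    SoloInformedPTerm.rep_pullback _ _ _
  have hterm_adm : ∀ t q, P.SoloInformedAdm (q ∘ Sum.inl) → (term' t).SoloInformedAdm q :=
    fun t q h => (SoloInformedPTerm.adm_pullback_iff _ _ _).2 (h t)
  have hAadm : ∀ q, cA.SoloInformedAdm q := fun q => SoloInformedPTerm.adm_const r q hr
  have hBadm : ∀ q, cB.SoloInformedAdm q := fun q => SoloInformedPTerm.adm_rectTerm q kℓ
  let Valid : (K ⊕ Fin 1 → ℝ) → Prop := fun q =>
    q ∘ Sum.inl ∈ V ∧ 0 ≤ q kℓ ∧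
    (∀ t t' (h : P.dim t = P.dim t'), P.key p₀ t = P.key p₀ t' →
      ((term' t).castDim h).SoloInformedCoin (term' t') q) ∧
    (∀ t (h : P.dim t = n), P.key p₀ t = ⟨n, r.baseChange ℝ⟩ →
      ((term' t).castDim h).SoloInformedCoin cA q) ∧
    (∀ t (h : P.dim t = 2), P.key p₀ t = ⟨2, soloInformedRealRect ℓ⟩ →
      ((term' t).castDim h).SoloInformedCoin cB q)
  -- (1) the clause set is `ℚ`-semialgebraic
  have hValid : IsSemialgebraic ℚ {q | Valid q} := by
    refine soloInformed_isSemialgebraic_setOf_and (hV.preimage_comp Sum.inl)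
      (soloInformed_isSemialgebraic_setOf_and (soloInformed_isSemialgebraic_setOf_coord_nonneg kℓ)
      (soloInformed_isSemialgebraic_setOf_and ?_ (soloInformed_isSemialgebraic_setOf_and ?_ ?_)))
    · exact soloInformed_isSemialgebraic_setOf_forall fun t =>
        soloInformed_isSemialgebraic_setOf_forall fun t' =>
        soloInformed_isSemialgebraic_setOf_forall_prop fun h =>
        soloInformed_isSemialgebraic_setOf_imp (soloInformed_isSemialgebraic_setOf_const _)
          (SoloInformedPTerm.isSemialgebraic_setOf_coin _ _)
    · exact soloInformed_isSemialgebraic_setOf_forall fun t =>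
        soloInformed_isSemialgebraic_setOf_forall_prop fun h =>
        soloInformed_isSemialgebraic_setOf_imp (soloInformed_isSemialgebraic_setOf_const _)
          (SoloInformedPTerm.isSemialgebraic_setOf_coin _ _)
    · exact soloInformed_isSemialgebraic_setOf_forall fun t =>
        soloInformed_isSemialgebraic_setOf_forall_prop fun h =>
        soloInformed_isSemialgebraic_setOf_imp (soloInformed_isSemialgebraic_setOf_const _)
          (SoloInformedPTerm.isSemialgebraic_setOf_coin _ _)
  -- (2) the original parameter satisfies the clauses
  let q₀ : K ⊕ Fin 1 → ℝ := Sum.elim p₀ fun _ => ℓ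
  have hq₀inl : q₀ ∘ Sum.inl = p₀ := Sum.elim_comp_inl _ _
  have hadm₀ : P.SoloInformedAdm (q₀ ∘ Sum.inl) := by rw [hq₀inl]; exact (hgood p₀ hp₀).1
  have hcast_rep₀ : ∀ t {m : ℕ} (h : P.dim t = m),
      ((term' t).castDim h).rep q₀ = SoloInformedPTerm.castRep h ((P.term t).rep p₀) := by
    intro t m h
    rw [SoloInformedPTerm.rep_castDim, hterm_rep, hq₀inl]
  have hValid₀ : Valid q₀ := by
    refine ⟨by rw [hq₀inl]; exact hp₀, by simp [q₀, kℓ, hℓ], fun t t' h hk => ?_, fun t h hk => ?_,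
      fun t h hk => ?_⟩
    · obtain ⟨h', hk'⟩ := (SoloInformedPTerm.sigma_mk_eq_iff _ _).1 hk
      refine SoloInformedPTerm.coin_of_rep_eq
        ((SoloInformedPTerm.adm_castDim_iff h _ _).2 (hterm_adm t _ hadm₀))
        (hterm_adm t' _ hadm₀) ?_
      rw [hcast_rep₀, hterm_rep, hq₀inl, ← hk']
    · obtain ⟨h', hk'⟩ := (SoloInformedPTerm.sigma_mk_eq_iff _ _).1 hk
      refine SoloInformedPTerm.coin_of_rep_eq
        ((SoloInformedPTerm.adm_castDim_iff h _ _).2 (hterm_adm t _ hadm₀)) (hAadm _) ?_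
      rw [hcast_rep₀, SoloInformedPTerm.rep_const r _ hr, ← hk']
    · obtain ⟨h', hk'⟩ := (SoloInformedPTerm.sigma_mk_eq_iff _ _).1 hk
      refine SoloInformedPTerm.coin_of_rep_eq
        ((SoloInformedPTerm.adm_castDim_iff h _ _).2 (hterm_adm t _ hadm₀)) (hBadm _) ?_
      rw [hcast_rep₀, SoloInformedPTerm.rep_rectTerm]
      exact hk'
  -- (3) on the clause set the height equals `value r`
  have hsound : ∀ q, Valid q → aeval q (X kℓ : MvPolynomial (K ⊕ Fin 1) ℚ) = r.value := by
    rintro q ⟨hqV, hqℓ, hcl, hclA, hclB⟩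
    have hadm : P.SoloInformedAdm (q ∘ Sum.inl) := (hgood _ hqV).1
    have hsum := P.sum_eq_of_combo_eq_sub hcombo hAB
      (fun t => ((P.term t).rep (q ∘ Sum.inl)).value) r.value (q kℓ) ?_ ?_ ?_
    · rw [P.sum_value_eq_zero _ (hgood _ hqV).2] at hsum
      rw [aeval_X]
      linarith
    · intro t t' hk
      have h : P.dim t = P.dim t' := congrArg Sigma.fst hk
      have hv := SoloInformedPTerm.value_eq_of_coin (hcl t t' h hk)
        ((SoloInformedPTerm.adm_castDim_iff h _ _).2 (hterm_adm t _ hadm)) (hterm_adm t' _ hadm)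
      rwa [SoloInformedPTerm.value_rep_castDim, hterm_rep, hterm_rep] at hv
    · intro t hk
      have h : P.dim t = n := congrArg Sigma.fst hk
      have hv := SoloInformedPTerm.value_eq_of_coin (hclA t h hk)
        ((SoloInformedPTerm.adm_castDim_iff h _ _).2 (hterm_adm t _ hadm)) (hAadm _)
      rwa [SoloInformedPTerm.value_rep_castDim, hterm_rep, SoloInformedPTerm.rep_const r _ hr,
        KZOver.IntegralRep.value_baseChange] at hv
    · intro t hk
      have h : P.dim t = 2 := congrArg Sigma.fst hk
      have hv := SoloInformedPTerm.value_eq_of_coin (hclB t h hk)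
        ((SoloInformedPTerm.adm_castDim_iff h _ _).2 (hterm_adm t _ hadm)) (hBadm _)
      rwa [SoloInformedPTerm.value_rep_castDim, hterm_rep, SoloInformedPTerm.rep_rectTerm,
        soloInformedRealRect_value hqℓ] at hv
  -- (4) a nonempty `ℚ`-semialgebraic set on which a coordinate is a transcendental constant
  haveI : Fintype K := hK
  exact (soloInformed_realParameter_barrier_core_fintype hValid (X kℓ) hsound).1 hτ q₀ hValid₀

/-- **THEOREM R, all heights.** Same conclusion for every real `ℓ` (for `ℓ < 0` the rectangle is
empty and has value `0 ≠ value r`). [cite: KontsevichZagier2001, §1.2, Conjecture 1] -/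
theorem soloInformed_realParameterBarrier_bdd'
    (hgen : ∀ c ∈ soloInformedBddGenerators ℝ, SoloInformedDefinableRel c)
    {n : ℕ} (r : KZOver.IntegralRep ℚ n) (hr : SoloInformedBddRep r)
    (hτ : Transcendental ℚ r.value) (ℓ : ℝ) :
    ¬ SoloInformedBddEquivalent (r.baseChange ℝ) (soloInformedRealRect ℓ) := by
  intro hc
  rcases le_or_gt 0 ℓ with hℓ | hℓ
  · exact soloInformed_realParameterBarrier_bdd hgen r hr hτ hℓ hc
  · have hv := hc.value_eq
    have hdom : (soloInformedRealRect ℓ).domain = ∅ := by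
      ext x
      rw [soloInformed_mem_rect_domain_iff]
      simp only [mem_empty_iff_false, iff_false, not_and, not_le]
      intro _ h1
      linarith
    have h0 : (soloInformedRealRect ℓ).value = 0 := by
      rw [KZOver.IntegralRep.value, hdom, Measure.restrict_empty, integral_zero_measure]
    rw [KZOver.IntegralRep.value_baseChange, h0] at hv
    exact hτ (hv ▸ isAlgebraic_zero)

end Summit.KontsevichZagierPeriods.KontsevichZagierPeriods.Theorems
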